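import Mathlib
import HarnessLib
import Summits.HubbardSuperconductivity.HubbardSuperconductivity.Theorems.KLProgrammeC4aAbsBubbleLevelLoop

/-!
# Route `KLProgramme` — crux C4a, S3 brick (B4) «(B4)-UMK1», part 5: the TUBE-ANGLE layer at a transversal caustic crossing — `|δ₀(ϑ)|^{−1/2}·log²` is integrable

Cell `gate-hubbard-kl`, seat hubbard-kl-k3c3-p3 (g27; row «implicit-function / monotonicity route for μ(n)»).  Located brick for the (C)-closer lane
hubbard-kl-c4a-1 (stub (C) `stub_twoLeg_curvature` of `KLRegimeEngineV17F2`, stmt-HubbardSuperconductivity-20437), design note HOME/hubbard-kl-k3c3-p3/B4-UMK1-DESIGN.md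
§4 (d).  Part 4 bounds the first-order umklapp jet at a configuration with caustic offset `δ₀` by `C·(1 + log⁺(Γ/|δ₀|))²·(1 + |δ₀|^{−1/2})`; across a TRANSVERSAL crossing
of the caustic in the tube angle (`|δ₀(ϑ)| ≥ κ|ϑ − ϑ_G|`, Gauss law + part 2's umklapp margin) this is an integrable singularity:
* `one_add_posLog_sq_le` (`(1 + log⁺(Γ/x))² ≤ 81(Γ/x)^{1/4}` for `0 < x ≤ Γ`, from `log y ≤ 8y^{1/8}`);
* `integral_rpow_neg_quarter`, `integral_rpow_neg_three_quarters` (`∫₀^δ x^{−1/4} = (4/3)δ^{3/4}`, `∫₀^δ x^{−3/4} = 4δ^{1/4}`);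
* **`intervalIntegral_caustic_window_le`**: `F ≥ 0` on `[c − δ, c + δ]` (`0 < δ ≤ Γ`), `F(ϑ) ≤ A₁(1 + log⁺(Γ/|ϑ − c|))²(1 + 1/√|ϑ − c|)` off the centre ⟹
  `∫_{c−δ}^{c+δ} F ≤ 2·81·A₁·Γ^{1/4}·((4/3)δ^{3/4} + 4δ^{1/4})` — the (U1) analogue of `…C4aAbsBubbleLevelLoop.intervalIntegral_cooper_window_le`.
Pure real analysis.  References: Salmhofer 1999 §4.5.3 [cite: Salmhofer1999]; FST II CPAM 51 (1998) §3 [cite: FeldmanSalmhoferTrubowitz1998].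
-/

noncomputable section

namespace Summit.HubbardSuperconductivity.HubbardSuperconductivity.Theorems.C4a

set_option linter.dupNamespace false -- summit = problem name (single-conjunct summit), D-0017

open Real Set MeasureTheory intervalIntegral

/-! ## §1 The logarithm against a small power -/

/-- `(1 + log⁺(Γ/x))² ≤ 81·(Γ/x)^{1/4}` for `0 < x ≤ Γ` (`log y ≤ 8y^{1/8}` for `y ≥ 1`). -/
theorem one_add_posLog_sq_le {Γ x : ℝ} (hx : 0 < x) (hxΓ : x ≤ Γ) : (1 + log⁺ (Γ / x)) ^ 2 ≤ 81 * (Γ / x) ^ (1 / 4 : ℝ) := by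
  have hy : 1 ≤ Γ / x := (one_le_div hx).2 hxΓ
  have hy0 : 0 ≤ Γ / x := zero_le_one.trans hy
  have hlog : log⁺ (Γ / x) = Real.log (Γ / x) := Real.posLog_eq_log (by rw [abs_of_nonneg hy0]; exact hy)
  have h8 : Real.log (Γ / x) ≤ (Γ / x) ^ (1 / 8 : ℝ) / (1 / 8) := Real.log_le_rpow_div hy0 (by norm_num)
  have hz1 : 1 ≤ (Γ / x) ^ (1 / 8 : ℝ) := Real.one_le_rpow hy (by norm_num)
  have h9 : 1 + log⁺ (Γ / x) ≤ 9 * (Γ / x) ^ (1 / 8 : ℝ) := by rw [hlog]; linarith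
  have hsq : ((Γ / x) ^ (1 / 8 : ℝ)) ^ 2 = (Γ / x) ^ (1 / 4 : ℝ) := by
    rw [← Real.rpow_natCast, ← Real.rpow_mul hy0]; norm_num
  have h0 : 0 ≤ 1 + log⁺ (Γ / x) := by have := Real.posLog_nonneg (x := Γ / x); linarith
  calc (1 + log⁺ (Γ / x)) ^ 2 ≤ (9 * (Γ / x) ^ (1 / 8 : ℝ)) ^ 2 := pow_le_pow_left₀ h0 h9 2
    _ = 81 * (Γ / x) ^ (1 / 4 : ℝ) := by rw [mul_pow, hsq]; norm_num

/-- `∫₀^δ x^{−1/4} dx = δ^{3/4}/(3/4)`. -/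
theorem integral_rpow_neg_quarter (δ : ℝ) : ∫ x in (0 : ℝ)..δ, x ^ (-(1 / 4) : ℝ) = δ ^ (3 / 4 : ℝ) / (3 / 4) := by
  rw [integral_rpow (Or.inl (by norm_num))]
  rw [show (-(1 / 4) : ℝ) + 1 = 3 / 4 by norm_num, Real.zero_rpow (by norm_num), sub_zero]

/-- `∫₀^δ x^{−3/4} dx = δ^{1/4}/(1/4)`. -/
theorem integral_rpow_neg_three_quarters (δ : ℝ) : ∫ x in (0 : ℝ)..δ, x ^ (-(3 / 4) : ℝ) = δ ^ (1 / 4 : ℝ) / (1 / 4) := by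
  rw [integral_rpow (Or.inl (by norm_num))]
  rw [show (-(3 / 4) : ℝ) + 1 = 1 / 4 by norm_num, Real.zero_rpow (by norm_num), sub_zero]

/-- The majorant at distance `x ∈ (0, Γ]` from the caustic angle: `(1 + log⁺(Γ/x))²(1 + 1/√x) ≤ 81Γ^{1/4}(x^{−1/4} + x^{−3/4})`. -/
theorem caustic_majorant_le {Γ x : ℝ} (hx : 0 < x) (hxΓ : x ≤ Γ) :
    (1 + log⁺ (Γ / x)) ^ 2 * (1 + (Real.sqrt x)⁻¹) ≤ 81 * Γ ^ (1 / 4 : ℝ) * (x ^ (-(1 / 4) : ℝ) + x ^ (-(3 / 4) : ℝ)) := by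
  have hΓ : 0 ≤ Γ := hx.le.trans hxΓ
  have h1 := one_add_posLog_sq_le hx hxΓ
  have hsplit : (Γ / x) ^ (1 / 4 : ℝ) = Γ ^ (1 / 4 : ℝ) * x ^ (-(1 / 4) : ℝ) := by
    rw [Real.div_rpow hΓ hx.le, Real.rpow_neg hx.le, div_eq_mul_inv]
  have hsqrt : (Real.sqrt x)⁻¹ = x ^ (-(1 / 2) : ℝ) := by
    rw [Real.sqrt_eq_rpow, Real.rpow_neg hx.le]
  have hprod : x ^ (-(1 / 4) : ℝ) * x ^ (-(1 / 2) : ℝ) = x ^ (-(3 / 4) : ℝ) := by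
    rw [← Real.rpow_add hx]; norm_num
  have hpos : 0 ≤ 1 + (Real.sqrt x)⁻¹ := by positivity
  calc (1 + log⁺ (Γ / x)) ^ 2 * (1 + (Real.sqrt x)⁻¹) ≤ 81 * (Γ / x) ^ (1 / 4 : ℝ) * (1 + (Real.sqrt x)⁻¹) :=
        mul_le_mul_of_nonneg_right h1 hpos
    _ = 81 * Γ ^ (1 / 4 : ℝ) * (x ^ (-(1 / 4) : ℝ) + x ^ (-(3 / 4) : ℝ)) := by
        rw [hsplit, hsqrt, mul_add, mul_one, ← hprod]; ring

/-! ## §2 The caustic window -/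

/-- **THE CAUSTIC WINDOW LAYER.**  `F ≥ 0` on `[c − δ, c + δ]` (`0 < δ ≤ Γ`, `A₁ ≥ 0`) with `F(ϑ) ≤ A₁(1 + log⁺(Γ/|ϑ − c|))²(1 + 1/√|ϑ − c|)` off the centre ⟹
`∫_{c−δ}^{c+δ} F ≤ 2·A₁·81·Γ^{1/4}·(δ^{3/4}/(3/4) + δ^{1/4}/(1/4))` — the first-order umklapp jet is integrable across a transversal caustic crossing.
(No integrability hypothesis on `F`.) -/
theorem intervalIntegral_caustic_window_le {F : ℝ → ℝ} {c δ Γ A₁ : ℝ} (hδ : 0 < δ) (hδΓ : δ ≤ Γ) (hA₁ : 0 ≤ A₁)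
    (hF0 : ∀ ϑ ∈ Icc (c - δ) (c + δ), 0 ≤ F ϑ)
    (hF : ∀ ϑ ∈ Icc (c - δ) (c + δ), ϑ ≠ c → F ϑ ≤ A₁ * ((1 + log⁺ (Γ / |ϑ - c|)) ^ 2 * (1 + (Real.sqrt |ϑ - c|)⁻¹))) :
    ∫ ϑ in (c - δ)..(c + δ), F ϑ ≤ 2 * (A₁ * (81 * Γ ^ (1 / 4 : ℝ)) * (δ ^ (3 / 4 : ℝ) / (3 / 4) + δ ^ (1 / 4 : ℝ) / (1 / 4))) := by
  have hΓ : 0 ≤ Γ := hδ.le.trans hδΓ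
  -- the value of the majorant on a half window
  have hhalf : ∫ x in (0 : ℝ)..δ, A₁ * (81 * Γ ^ (1 / 4 : ℝ)) * (x ^ (-(1 / 4) : ℝ) + x ^ (-(3 / 4) : ℝ)) =
      A₁ * (81 * Γ ^ (1 / 4 : ℝ)) * (δ ^ (3 / 4 : ℝ) / (3 / 4) + δ ^ (1 / 4 : ℝ) / (1 / 4)) := by
    rw [intervalIntegral.integral_const_mul, intervalIntegral.integral_add (intervalIntegral.intervalIntegrable_rpow' (by norm_num))
      (intervalIntegral.intervalIntegrable_rpow' (by norm_num)), integral_rpow_neg_quarter, integral_rpow_neg_three_quarters]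
  have hRHS1 : 0 ≤ A₁ * (81 * Γ ^ (1 / 4 : ℝ)) * (δ ^ (3 / 4 : ℝ) / (3 / 4) + δ ^ (1 / 4 : ℝ) / (1 / 4)) := by positivity
  by_cases hint : IntervalIntegrable F volume (c - δ) (c + δ)
  swap
  · rw [intervalIntegral.integral_undef hint]; linarith
  have hi1 : IntervalIntegrable F volume (c - δ) c :=
    hint.mono_set (by rw [uIcc_of_le (by linarith), uIcc_of_le (by linarith)]; exact Icc_subset_Icc le_rfl (by linarith))
  have hi2 : IntervalIntegrable F volume c (c + δ) :=
    hint.mono_set (by rw [uIcc_of_le (by linarith), uIcc_of_le (by linarith)]; exact Icc_subset_Icc (by linarith) le_rfl)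
  rw [← intervalIntegral.integral_add_adjacent_intervals hi1 hi2]
  -- the majorant as a function of the distance to the centre
  set g : ℝ → ℝ := fun x => A₁ * (81 * Γ ^ (1 / 4 : ℝ)) * (x ^ (-(1 / 4) : ℝ) + x ^ (-(3 / 4) : ℝ)) with hg
  have hgi : ∀ a b : ℝ, IntervalIntegrable g volume a b := fun a b =>
    ((intervalIntegral.intervalIntegrable_rpow' (by norm_num)).add (intervalIntegral.intervalIntegrable_rpow' (by norm_num))).const_mul _
  have hmaj : ∀ x : ℝ, 0 < x → x ≤ δ → A₁ * ((1 + log⁺ (Γ / x)) ^ 2 * (1 + (Real.sqrt x)⁻¹)) ≤ g x := fun x hx hxδ => by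
    rw [hg]
    have h := caustic_majorant_le hx (hxδ.trans hδΓ)
    have := mul_le_mul_of_nonneg_left h hA₁
    linarith [this]
  -- right half `[c, c + δ]`, distance `x = ϑ − c`
  have hright : ∫ ϑ in c..(c + δ), F ϑ ≤ A₁ * (81 * Γ ^ (1 / 4 : ℝ)) * (δ ^ (3 / 4 : ℝ) / (3 / 4) + δ ^ (1 / 4 : ℝ) / (1 / 4)) := by
    have hmi : IntervalIntegrable (fun ϑ => g (ϑ - c)) volume c (c + δ) := by
      have h := (hgi (c - c) (c + δ - c)).comp_sub_right c
      simp only [sub_add_cancel, sub_self, zero_add] at h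
      exact h
    have hle : ∫ ϑ in c..(c + δ), F ϑ ≤ ∫ ϑ in c..(c + δ), g (ϑ - c) := by
      rw [intervalIntegral.integral_of_le (by linarith), intervalIntegral.integral_of_le (by linarith)]
      refine integral_mono_of_nonneg ?_ hmi.1 ?_
      · exact (ae_restrict_iff' measurableSet_Ioc).2 (Filter.Eventually.of_forall fun ϑ hϑ => hF0 ϑ ⟨by linarith [hϑ.1], hϑ.2⟩)
      · refine (ae_restrict_iff' measurableSet_Ioc).2 (Filter.Eventually.of_forall fun ϑ hϑ => ?_)
        have hx : 0 < ϑ - c := by linarith [hϑ.1]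
        have h := hF ϑ ⟨by linarith [hϑ.1], hϑ.2⟩ (ne_of_gt hϑ.1)
        rw [abs_of_pos hx] at h
        exact h.trans (hmaj (ϑ - c) hx (by linarith [hϑ.2]))
    refine hle.trans (le_of_eq ?_)
    rw [intervalIntegral.integral_comp_sub_right g c, sub_self, show c + δ - c = δ by ring, hg, hhalf]
  -- left half `[c − δ, c]`, distance `x = c − ϑ`
  have hleft : ∫ ϑ in (c - δ)..c, F ϑ ≤ A₁ * (81 * Γ ^ (1 / 4 : ℝ)) * (δ ^ (3 / 4 : ℝ) / (3 / 4) + δ ^ (1 / 4 : ℝ) / (1 / 4)) := by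
    have hmi : IntervalIntegrable (fun ϑ => g (c - ϑ)) volume (c - δ) c := by
      have h := (hgi (c - (c - δ)) (c - c)).comp_sub_left c
      simpa using h
    have hle : ∫ ϑ in (c - δ)..c, F ϑ ≤ ∫ ϑ in (c - δ)..c, g (c - ϑ) := by
      rw [intervalIntegral.integral_of_le (by linarith), intervalIntegral.integral_of_le (by linarith), integral_Ioc_eq_integral_Ioo,
        integral_Ioc_eq_integral_Ioo]
      refine integral_mono_of_nonneg ?_ (hmi.1.mono_set Ioo_subset_Ioc_self) ?_
      · exact (ae_restrict_iff' measurableSet_Ioo).2 (Filter.Eventually.of_forall fun ϑ hϑ => hF0 ϑ ⟨hϑ.1.le, by linarith [hϑ.2]⟩)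
      · refine (ae_restrict_iff' measurableSet_Ioo).2 (Filter.Eventually.of_forall fun ϑ hϑ => ?_)
        have hx : 0 < c - ϑ := by linarith [hϑ.2]
        have h := hF ϑ ⟨hϑ.1.le, by linarith [hϑ.2]⟩ (ne_of_lt hϑ.2)
        rw [abs_sub_comm, abs_of_pos hx] at h
        exact h.trans (hmaj (c - ϑ) hx (by linarith [hϑ.1]))
    refine hle.trans (le_of_eq ?_)
    rw [intervalIntegral.integral_comp_sub_left g c, sub_self, show c - (c - δ) = δ by ring, hg, hhalf]
  linarith

end Summit.HubbardSuperconductivity.HubbardSuperconductivity.Theorems.C4a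

end
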